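import Summits.QuantumFields.YangMills.Theorems.BalabanUVNodesN18U3LettersOfLocalTermsPackage

/-!
# BalabanUVNodes ∕ N18 (node U3's kernel objects) — THE TERM-DATA PACKAGE AT THE PINS: the three kernel-side U3 inputs of the (Kꜰ) pin (`KernelDecayOfRecord₁₃ ∧ ∀ k, N18At ∧
# ∀ k, N22At` at the ₁₃ objects of record) and the N18 conjunct of a kernel-pinned K3 reading, from the ONE term-data package of PART 1 plus the n22 lane's two finite-volume
# letters `h9 ∕ hW` (DISPLAYED) at a letter reading `ℓ` keyed to the package's constants
# (Track A, DAG node N18 = NE5 ∕ node U3's letters; key K3⁸ `SpineGivenEndpointR13SepCoPHV` = stmt-QuantumFields-27366; cell `pub-ymgap`, WIDTH SEAT `pub-ymgap-dag-n18-w2` g10,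
# FILE 2; `--kind proof --supports stmt-QuantumFields-27366 --as helper`, COUNT-NEUTRAL; THEOREMS ONLY, 0 `def`, 0 `sorry`)

WHY.  PART 1 (`…N18U3LettersOfLocalTermsPackage`) delivers node U3's four letters of record this lineage produces — `GeometricIncrementsOfRecord₁₃ … r_inc` (`r_inc < 1`),
`PolLimitsExistOfRecord₁₃`, `WindowedStepRateOfRecord₁₃ … 1 δ₁ θ₅ (C₅′θ₅)`, `KernelStepRateOfRecord₁₃ … δ₁ θ₅ C₅′` — from ONE data list.  The consumers one level up read
node U3 through a LETTER READING `ℓ : U3Letters₁₁` (g6 `u3KernelInputs_of_finiteVolumeLetters`: `ℓ.Signs` + `hinc` + `hS` at `(ℓ.κ, ℓ.θ₅, ℓ.C₅)` + the n22 lane's `h9` (windowed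
joint history-Lipschitz bounds, moduli `ℓ.moduli`) + `hW` (windowed (5.10) bounds at the pair `(0,1)`) ⇒ `KernelDecayOfRecord₁₃ F N θ 0 1 ℓ.κ ∧ (∀ k, N18At …) ∧ ∀ k, N22At …`,
the `hdec ∕ h18 ∕ h22` of dag-n27-w1's (Kꜰ) pin) and through a kernel-PINNED rate reading (g6 `n18At_rateCarriers_of_kernels_pin_of_geometricIncrements`).  THIS FILE keys the
letter reading to the package's constants — `ℓ.κ = δ₁`, `ℓ.θ₅ = θ₅`, `ℓ.C₅ = C₅′` (equations, so that a reading defined elsewhere is served) — and composes: the U3 block of the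
pin from the term-data package + `ℓ.Signs` + `h9 ∕ hW` (n22 lane, DISPLAYED at `ℓ.κ`), in the chart-data and in the analytic edition, and the N18 conjunct of a kernel-pinned
reading at EVERY run length `k`.

WHAT: ★★ `u3KernelInputs_of_localTermData` (chart-data edition) · ★★ `u3KernelInputs_of_analyticLocalTermData` (analytic edition) · ★ `n18At_rateCarriers_pin_of_analyticLocalTermData`
(under `hpin : (𝔯.lit F θ hP g₀ os).u3 = objectsOfRecord₁₃ F N θ.toStage13Params ℓ`: `N18At (rateCarriersOfRecord₁₃CoPH 𝔯 F θ hP g₀ os k).u3` for every `k`, no `h9 ∕ hW` needed).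

HONEST FRAMING — what this is NOT.  Count-neutral composition (PART 1 + g6's junctions); NO estimate of Bałaban's is proved or asserted — W1-20's law, the analytic
representations with tails and (1.18) decay (NODE A ∕ N10), the local stability rate, the TERM-LEVEL TWO-RUN SUP BOUND (node N18's content, NOT PRINTED for d = 4), the n22
lane's `h9 ∕ hW` and `ℓ.Signs` are DISPLAYED hypotheses; no letter OF RECORD inhabited; N18 ∕ N22 ∕ (D4) NOT discharged; K3⁸ OPEN (skeleton v6 untouched), not claimed; counts
UNMOVED (typed 28∕28 · discharged 5∕27 (A 5∕28)); one finite four-torus programme at fixed ε, Bałaban AS PRINTED; R4 closes the conditional finite-𝕋⁴ rung `BalabanLadder.UV` only —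
NOT ℝ⁴, NOT infinite volume, NOT OS, NOT a mass gap; the Clay problem is NOT proved by any of this.

References (TYPES only): [I] = [Balaban1987RG1] Thm 1 p. 259, (1.7) p. 261, (1.18) p. 263, (1.20)–(1.22) p. 264, (4.35)–(4.37) pp. 290–291, (5.10) p. 293; [II] =
[Balaban1988RG2Cluster] (2.13)–(2.14) pp. 14–15; [King1986] (3.73) p. 665.  Imports PART 1 (through it g9 FILES 4∕7, g6) BY NAME; nothing re-declared.
-/

noncomputable section

namespace YMDAG.N18.U3LettersPackage

open Filter Metric Set
open scoped BigOperators Topology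
open Literature.MathematicalPhysics.QuantumFieldTheory.Balaban1983to89
open Literature.MathematicalPhysics.QuantumFieldTheory.Balaban1983to89.T4Continuum (T4Family ULoop)
open Literature.MathematicalPhysics.QuantumFieldTheory.Balaban1983to89.FlowStep (Box)
open Literature.MathematicalPhysics.QuantumFieldTheory.Balaban1983to89.B12PolarizationTensor120 (polComp expChart)
open Literature.MathematicalPhysics.QuantumFieldTheory.Balaban1983to89.Node00 (Stage13Params Stage13HParams polScalar siteOfInt MatA U3Letters₁₁)
open Literature.MathematicalPhysics.QuantumFieldTheory.Balaban1983to89.Node00.U3OfKernels (histPrefix objectsOfRecord₁₃ KernelDecayOfRecord₁₃)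
open Literature.MathematicalPhysics.QuantumFieldTheory.Balaban1983to89.Node00.U3KernelLetters (WindowedStepRateOfRecord₁₃ WindowedNE9OfRecord₁₃ WindowedDecayOfRecord₁₃)
open Literature.MathematicalPhysics.QuantumFieldTheory.Balaban1983to89.Node00.LocalizedSum17 (ReadingMaps Localizes17OfRecord₁₃)
open Literature.MathematicalPhysics.QuantumFieldTheory.Balaban1983to89.Node00.Sect2 (domSys domCount)
open Literature.MathematicalPhysics.QuantumFieldTheory.Balaban1983to89.Node00.W1 (ClusterTower castDom domSys_succ)
open Literature.MathematicalPhysics.QuantumFieldTheory.Balaban1983to89.T4LevelShift (siteShift)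
open Literature.MathematicalPhysics.QuantumFieldTheory.Balaban1983to89.T4OutputRate (Window)
open Literature.MathematicalPhysics.QuantumFieldTheory.Balaban1983to89.B12Decay510 (delta1)
open Literature.MathematicalPhysics.QuantumFieldTheory.Balaban1983to89.B12Decay510Window (K₁)
open Literature.MathematicalPhysics.QuantumFieldTheory.Balaban1983to89.B12Decay510Torus (distCT nearT)
open Literature.MathematicalPhysics.QuantumFieldTheory.Balaban1983to89.B12TreeDecay (K₀ kappa₀)
open Literature.MathematicalPhysics.QuantumFieldTheory.Balaban1983to89.TreeLengthTorus (TPt torusTreeLen)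
open YMDAG.N18.TwoRunWindowLevelShift (ladder)
open YMDAG.N18.PolLimitRate (u3KernelInputs_of_finiteVolumeLetters n18At_rateCarriers_of_kernels_pin_of_geometricIncrements)
open YMDAG.UVSplit (N18At N22At u3OfRecord₁₃ RateReading₁₃CoPH rateCarriersOfRecord₁₃CoPH)

section Objects

open scoped Matrix.Norms.L2Operator

variable {𝔸 : Type*} {Ec : Type*} [NormedAddCommGroup Ec] [NormedSpace ℂ Ec]
variable (F : T4Family) (N : ℕ) [NeZero N] (m' : ℕ) (M : ℕ) [NeZero M] (hM : M = F.L ^ m')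

include hM in
open Classical in
/-- ★★ **THE THREE KERNEL-SIDE U3 INPUTS OF THE (Kꜰ) PIN FROM THE TERM-DATA PACKAGE + `h9 ∕ hW`** (chart-data edition).  At a letter reading `ℓ` keyed to the package's
constants (`ℓ.κ = δ₁`, `ℓ.θ₅ = θ₅`, `ℓ.C₅ = C₅′`) with `ℓ.Signs`: PART 1's hypotheses (W1-20's law, `C²` charts, soft value majorants, local stability rate, two-run holomorphic data
with the term-level sup bound) + the n22 lane's finite-volume letters `WindowedNE9OfRecord₁₃ F N θ ℓ.κ ℓ.moduli` and `WindowedDecayOfRecord₁₃ F N θ 0 1 ℓ.κ` (DISPLAYED) ⇒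
`KernelDecayOfRecord₁₃ F N θ 0 1 ℓ.κ ∧ (∀ k, N18At (u3OfRecord₁₃ θ (objectsOfRecord₁₃ F N θ ℓ) k)) ∧ ∀ k, N22At (u3OfRecord₁₃ θ (objectsOfRecord₁₃ F N θ ℓ) k)` (PART 1 §2 ∘ g6
`u3KernelInputs_of_finiteVolumeLetters` at `s := 1`).  LOCATED; N18 ∕ N22 ∕ (D4) NOT discharged.
[cite: Balaban1987RG1, Thm 1 p.259, (1.7) p.261, (1.18) p.263, (1.20)-(1.22) p.264 and (5.10) p.293; Balaban1988RG2Cluster, (2.13)-(2.14) pp.14-15; King1986, (3.73) p.665] -/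
theorem u3KernelInputs_of_localTermData (θ : Stage13Params F N) (S : (K : ℕ) → ClusterTower (F.P K) 𝔸 M) (emb : ReadingMaps F (MatA N) 𝔸)
    (hloc : Localizes17OfRecord₁₃ F N θ S emb) {κ δ₀ a ω : ℝ} (hκ0 : 0 < κ) (hδ₀ : 0 < δ₀) (hκ : kappa₀ (4 * 2 ^ 4) (2 * 4) ≤ κ / 2 / 2) (ha : 0 ≤ a)
    (hω : 0 < ω) (hω1 : ω < 1)
    (hC : letI := θ.instVβ₁; letI := θ.instVβ₂
      ∀ g ∈ Window θ.γ, ∀ (k K : ℕ) (X : (domSys (F.P K) M (k + 1)).Dom),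
        ContDiffAt ℝ 2 (expChart (fun W' => (((S K) k).E (histPrefix g k) (emb K k W') X).re) θ.ρ8) 0)
    (hval : letI := θ.instVβ₁; letI := θ.instVβ₂; letI := θ.instιβ
      ∀ g ∈ Window θ.γ, ∀ (k : ℕ) (μ ν : Fin 4) (z : Fin 4 → ℤ), ∃ CE : ℝ, 0 ≤ CE ∧ ∀ (K : ℕ) (X : (domSys (F.P K) M (k + 1)).Dom) (c : θ.ιβ),
        let e : Site (F.P K) (k + 1) → TPt 4 (domCount (F.P K) M (k + 1) * M) := fun x i => (ZMod.cast (x i) : ZMod (domCount (F.P K) M (k + 1) * M))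
        |polComp ℝ (expChart (fun W' => (((S K) k).E (histPrefix g k) (emb K k W') X).re) θ.ρ8) θ.bV (Fin.cast (F.P_d K).symm μ) (siteOfInt F K (k + 1) z) c
            (Fin.cast (F.P_d K).symm ν) (siteOfInt F K (k + 1) 0) c| ≤
          CE * Real.exp (-κ * torusTreeLen X.1) * Real.exp (-δ₀ * distCT (domCount (F.P K) M (k + 1)) M (e (siteOfInt F K (k + 1) z)) (nearT (M := M) (e (siteOfInt F K (k + 1) z)) X)) *
            Real.exp (-δ₀ * distCT (domCount (F.P K) M (k + 1)) M (e (siteOfInt F K (k + 1) 0)) (nearT (M := M) (e (siteOfInt F K (k + 1) 0)) X)))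
    (hstab : letI := θ.instVβ₁; letI := θ.instVβ₂; letI := θ.instιβ
      ∀ g ∈ Window θ.γ, ∀ (k : ℕ) (μ ν : Fin 4) (z : Fin 4 → ℤ), ∃ (Ks : ℕ) (A : ℝ), 0 ≤ A ∧ ∀ R : ℝ, 0 ≤ R → ∀ K, Ks ≤ K →
        |(∑ X ∈ Finset.univ.filter (fun X : (domSys (F.P (K + 1)) M (k + 1)).Dom =>
            ¬ (R < torusTreeLen X.1 ∨ R < distCT (domCount (F.P (K + 1)) M (k + 1)) M
              (fun i : Fin 4 => (ZMod.cast (siteOfInt F (K + 1) (k + 1) 0 i) : ZMod (domCount (F.P (K + 1)) M (k + 1) * M)))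
              (nearT (M := M) (fun i : Fin 4 => (ZMod.cast (siteOfInt F (K + 1) (k + 1) 0 i) : ZMod (domCount (F.P (K + 1)) M (k + 1) * M))) X))),
            polScalar (fun W' => (((S (K + 1)) k).E (histPrefix g k) (emb (K + 1) k W') X).re) θ.ρ8 θ.bV (Fin.cast (F.P_d (K + 1)).symm μ) (siteOfInt F (K + 1) (k + 1) z)
              (Fin.cast (F.P_d (K + 1)).symm ν) (siteOfInt F (K + 1) (k + 1) 0)) -
          (∑ X ∈ Finset.univ.filter (fun X : (domSys (F.P K) M (k + 1)).Dom =>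
            ¬ (R < torusTreeLen X.1 ∨ R < distCT (domCount (F.P K) M (k + 1)) M
              (fun i : Fin 4 => (ZMod.cast (siteOfInt F K (k + 1) 0 i) : ZMod (domCount (F.P K) M (k + 1) * M)))
              (nearT (M := M) (fun i : Fin 4 => (ZMod.cast (siteOfInt F K (k + 1) 0 i) : ZMod (domCount (F.P K) M (k + 1) * M))) X))),
            polScalar (fun W' => (((S K) k).E (histPrefix g k) (emb K k W') X).re) θ.ρ8 θ.bV (Fin.cast (F.P_d K).symm μ) (siteOfInt F K (k + 1) z)
              (Fin.cast (F.P_d K).symm ν) (siteOfInt F K (k + 1) 0))| ≤ A * Real.exp (a * R) * ω ^ K)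
    {θ₅ r M₀ B₃ : ℝ} (hθ₅ : 0 ≤ θ₅) (hr : 0 < r) (hM₀ : 0 ≤ M₀) (hB₃ : 0 ≤ B₃)
    (ιc : letI := θ.instVβ₁; letI := θ.instVβ₂
      (k : ℕ) → (Fin (k + 2) → ℝ) → (K : ℕ) → (domSys (F.P (K + 1)) M (k + 1 + 1)).Dom → ((Fin (F.P (K + 1)).d → Site (F.P (K + 1)) (k + 1 + 1) → θ.Vβ) →L[ℝ] Ec))
    (GB GA : (k : ℕ) → (Fin (k + 2) → ℝ) → (K : ℕ) → (domSys (F.P (K + 1)) M (k + 1 + 1)).Dom → Ec → ℂ)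
    (U : (k : ℕ) → (Fin (k + 2) → ℝ) → (K : ℕ) → (domSys (F.P (K + 1)) M (k + 1 + 1)).Dom → Set Ec) (hU : ∀ k w K X, IsOpen (U k w K X))
    (hGB : ∀ k w K X, DifferentiableOn ℂ (GB k w K X) (U k w K X)) (hGA : ∀ k w K X, DifferentiableOn ℂ (GA k w K X) (U k w K X))
    (hrU : ∀ k w K X, ball (0 : Ec) r ⊆ U k w K X)
    (hfB : letI := θ.instVβ₁; letI := θ.instVβ₂
      ∀ (k : ℕ) (w : Fin (k + 2) → ℝ), w ∈ Box θ.γ (k + 1) → ∀ (K : ℕ) (X : (domSys (F.P (K + 1)) M (k + 1 + 1)).Dom) (B),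
        expChart (fun W' => (((S (K + 1)) (k + 1)).E w (emb (K + 1) (k + 1) W') X).re) θ.ρ8 B = (GB k w K X (ιc k w K X B)).re)
    (hfA : letI := θ.instVβ₁; letI := θ.instVβ₂
      ∀ (k : ℕ) (w : Fin (k + 2) → ℝ), w ∈ Box θ.γ (k + 1) → ∀ (K : ℕ) (X : (domSys (F.P (K + 1)) M (k + 1 + 1)).Dom) (B),
        expChart (fun W' : Fin (F.P (K + 1)).d → Site (F.P (K + 1)) (k + 1 + 1) → MatA N =>
          (((S K) k).E (Fin.tail w) (emb K k (fun κ' y => W' κ' (siteShift (ladder F K k) y))) (castDom (domSys_succ F M K (k + 1)) X)).re) θ.ρ8 B =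
          (GA k w K X (ιc k w K X B)).re)
    (hsup : ∀ (k : ℕ) (w : Fin (k + 2) → ℝ), w ∈ Box θ.γ (k + 1) → ∀ (K : ℕ) (X : (domSys (F.P (K + 1)) M (k + 1 + 1)).Dom), ∀ ζ ∈ ball (0 : Ec) r,
      ‖GB k w K X ζ - GA k w K X ζ‖ ≤ M₀ * θ₅ ^ (k + 1) * Real.exp (-κ * torusTreeLen X.1))
    (htail : letI := θ.instVβ₁; letI := θ.instVβ₂; letI := θ.instιβ
      ∀ (k : ℕ) (w : Fin (k + 2) → ℝ) (K : ℕ) (X : (domSys (F.P (K + 1)) M (k + 1 + 1)).Dom) (l : Fin (F.P (K + 1)).d) (t : Site (F.P (K + 1)) (k + 1 + 1)) (c : θ.ιβ),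
        let e : Site (F.P (K + 1)) (k + 1 + 1) → TPt 4 (domCount (F.P (K + 1)) M (k + 1 + 1) * M) :=
          fun x i => (ZMod.cast (x i) : ZMod (domCount (F.P (K + 1)) M (k + 1 + 1) * M))
        ‖ιc k w K X (Pi.single l (Pi.single t (θ.bV c)))‖ ≤ B₃ * Real.exp (-δ₀ * distCT (domCount (F.P (K + 1)) M (k + 1 + 1)) M (e t) (nearT (M := M) (e t) X)))
    (ℓ : U3Letters₁₁) (hs : ℓ.Signs) (hℓκ : ℓ.κ = delta1 δ₀ κ ((M : ℝ) * 4)) (hℓθ : ℓ.θ₅ = θ₅)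
    (hℓC : ℓ.C₅ = 16 * M₀ * B₃ ^ 2 / r ^ 2 * Real.exp (delta1 δ₀ κ ((M : ℝ) * 4) * ((M : ℝ) * 4) * 3) * K₀ (4 * 2 ^ 4) (2 * 4) * K₁ 4 (δ₀ / 2))
    (h9 : WindowedNE9OfRecord₁₃ F N θ ℓ.κ ℓ.moduli) (hW : WindowedDecayOfRecord₁₃ F N θ 0 1 ℓ.κ) :
    KernelDecayOfRecord₁₃ F N θ 0 1 ℓ.κ ∧ (∀ k : ℕ, N18At (u3OfRecord₁₃ θ (objectsOfRecord₁₃ F N θ ℓ) k)) ∧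
      ∀ k : ℕ, N22At (u3OfRecord₁₃ θ (objectsOfRecord₁₃ F N θ ℓ) k) := by
  obtain ⟨hrr, hinc, -, hS, -⟩ := u3LettersOfRecord₁₃_of_localTermData F N m' M hM θ S emb hloc hκ0 hδ₀ hκ ha hω hω1 hC hval hstab hθ₅ hr hM₀ hB₃ ιc GB GA U
    hU hGB hGA hrU hfB hfA hsup htail
  have hfin : WindowedStepRateOfRecord₁₃ F N θ 1 ℓ.κ ℓ.θ₅ (ℓ.C₅ * ℓ.θ₅) := by rw [hℓκ, hℓθ, hℓC]; exact hS
  exact u3KernelInputs_of_finiteVolumeLetters F N θ ℓ hs 1 hrr hinc hfin h9 hW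

include hM in
open Classical in
/-- ★★ **THE THREE KERNEL-SIDE U3 INPUTS OF THE (Kꜰ) PIN — ANALYTIC EDITION**: the same with PART 1 §1b's single-run analytic input (per `(g ∈ Window θ.γ, k, K, X)`: `ι`
with the (4.35) tails, `G` holomorphic on `U ⊇ ball 0 r`, `expChart(term) θ.ρ8 = Re G ∘ ι`, `‖G‖ ≤ E₀e^{−κd(X)}` on the ball) in place of `hC ∕ hval`.  LOCATED; N18 ∕ N22 ∕ (D4)
NOT discharged. [cite: Balaban1987RG1, Thm 1 p.259, (1.7) p.261, (1.18) p.263, (1.20)-(1.22) p.264, (4.35)-(4.36) p.290, (4.37) p.291 and (5.10) p.293; Balaban1988RG2Cluster, (2.13)-(2.14) pp.14-15; King1986, (3.73) p.665] -/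
theorem u3KernelInputs_of_analyticLocalTermData (θ : Stage13Params F N) (S : (K : ℕ) → ClusterTower (F.P K) 𝔸 M) (emb : ReadingMaps F (MatA N) 𝔸)
    (hloc : Localizes17OfRecord₁₃ F N θ S emb) {κ δ₀ a ω r E₀ B₃ : ℝ} (hκ0 : 0 < κ) (hδ₀ : 0 < δ₀) (hκ : kappa₀ (4 * 2 ^ 4) (2 * 4) ≤ κ / 2 / 2) (ha : 0 ≤ a)
    (hω : 0 < ω) (hω1 : ω < 1) (hr : 0 < r) (hE₀ : 0 ≤ E₀) (hB₃ : 0 ≤ B₃)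
    (ι₁ : letI := θ.instVβ₁; letI := θ.instVβ₂
      (g : ℕ → ℝ) → (k K : ℕ) → (domSys (F.P K) M (k + 1)).Dom → ((Fin (F.P K).d → Site (F.P K) (k + 1) → θ.Vβ) →L[ℝ] Ec))
    (G₁ : (g : ℕ → ℝ) → (k K : ℕ) → (domSys (F.P K) M (k + 1)).Dom → Ec → ℂ)
    (U₁ : (g : ℕ → ℝ) → (k K : ℕ) → (domSys (F.P K) M (k + 1)).Dom → Set Ec) (hU₁ : ∀ g k K X, IsOpen (U₁ g k K X))
    (hG₁ : ∀ g k K X, DifferentiableOn ℂ (G₁ g k K X) (U₁ g k K X)) (hrU₁ : ∀ g k K X, ball (0 : Ec) r ⊆ U₁ g k K X)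
    (hf₁ : letI := θ.instVβ₁; letI := θ.instVβ₂
      ∀ g ∈ Window θ.γ, ∀ (k K : ℕ) (X : (domSys (F.P K) M (k + 1)).Dom) (B : Fin (F.P K).d → Site (F.P K) (k + 1) → θ.Vβ),
        expChart (fun W' => (((S K) k).E (histPrefix g k) (emb K k W') X).re) θ.ρ8 B = (G₁ g k K X (ι₁ g k K X B)).re)
    (hsup₁ : ∀ g ∈ Window θ.γ, ∀ (k K : ℕ) (X : (domSys (F.P K) M (k + 1)).Dom), ∀ ζ ∈ ball (0 : Ec) r, ‖G₁ g k K X ζ‖ ≤ E₀ * Real.exp (-κ * torusTreeLen X.1))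
    (htail₁ : letI := θ.instVβ₁; letI := θ.instVβ₂; letI := θ.instιβ
      ∀ (g : ℕ → ℝ) (k K : ℕ) (X : (domSys (F.P K) M (k + 1)).Dom) (l : Fin (F.P K).d) (t : Site (F.P K) (k + 1)) (c : θ.ιβ),
        let e : Site (F.P K) (k + 1) → TPt 4 (domCount (F.P K) M (k + 1) * M) := fun x i => (ZMod.cast (x i) : ZMod (domCount (F.P K) M (k + 1) * M))
        ‖ι₁ g k K X (Pi.single l (Pi.single t (θ.bV c)))‖ ≤ B₃ * Real.exp (-δ₀ * distCT (domCount (F.P K) M (k + 1)) M (e t) (nearT (M := M) (e t) X)))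
    (hstab : letI := θ.instVβ₁; letI := θ.instVβ₂; letI := θ.instιβ
      ∀ g ∈ Window θ.γ, ∀ (k : ℕ) (μ ν : Fin 4) (z : Fin 4 → ℤ), ∃ (Ks : ℕ) (A : ℝ), 0 ≤ A ∧ ∀ R : ℝ, 0 ≤ R → ∀ K, Ks ≤ K →
        |(∑ X ∈ Finset.univ.filter (fun X : (domSys (F.P (K + 1)) M (k + 1)).Dom =>
            ¬ (R < torusTreeLen X.1 ∨ R < distCT (domCount (F.P (K + 1)) M (k + 1)) M
              (fun i : Fin 4 => (ZMod.cast (siteOfInt F (K + 1) (k + 1) 0 i) : ZMod (domCount (F.P (K + 1)) M (k + 1) * M)))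
              (nearT (M := M) (fun i : Fin 4 => (ZMod.cast (siteOfInt F (K + 1) (k + 1) 0 i) : ZMod (domCount (F.P (K + 1)) M (k + 1) * M))) X))),
            polScalar (fun W' => (((S (K + 1)) k).E (histPrefix g k) (emb (K + 1) k W') X).re) θ.ρ8 θ.bV (Fin.cast (F.P_d (K + 1)).symm μ) (siteOfInt F (K + 1) (k + 1) z)
              (Fin.cast (F.P_d (K + 1)).symm ν) (siteOfInt F (K + 1) (k + 1) 0)) -
          (∑ X ∈ Finset.univ.filter (fun X : (domSys (F.P K) M (k + 1)).Dom =>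
            ¬ (R < torusTreeLen X.1 ∨ R < distCT (domCount (F.P K) M (k + 1)) M
              (fun i : Fin 4 => (ZMod.cast (siteOfInt F K (k + 1) 0 i) : ZMod (domCount (F.P K) M (k + 1) * M)))
              (nearT (M := M) (fun i : Fin 4 => (ZMod.cast (siteOfInt F K (k + 1) 0 i) : ZMod (domCount (F.P K) M (k + 1) * M))) X))),
            polScalar (fun W' => (((S K) k).E (histPrefix g k) (emb K k W') X).re) θ.ρ8 θ.bV (Fin.cast (F.P_d K).symm μ) (siteOfInt F K (k + 1) z)
              (Fin.cast (F.P_d K).symm ν) (siteOfInt F K (k + 1) 0))| ≤ A * Real.exp (a * R) * ω ^ K)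
    {θ₅ M₀ : ℝ} (hθ₅ : 0 ≤ θ₅) (hM₀ : 0 ≤ M₀)
    (ιc : letI := θ.instVβ₁; letI := θ.instVβ₂
      (k : ℕ) → (Fin (k + 2) → ℝ) → (K : ℕ) → (domSys (F.P (K + 1)) M (k + 1 + 1)).Dom → ((Fin (F.P (K + 1)).d → Site (F.P (K + 1)) (k + 1 + 1) → θ.Vβ) →L[ℝ] Ec))
    (GB GA : (k : ℕ) → (Fin (k + 2) → ℝ) → (K : ℕ) → (domSys (F.P (K + 1)) M (k + 1 + 1)).Dom → Ec → ℂ)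
    (U : (k : ℕ) → (Fin (k + 2) → ℝ) → (K : ℕ) → (domSys (F.P (K + 1)) M (k + 1 + 1)).Dom → Set Ec) (hU : ∀ k w K X, IsOpen (U k w K X))
    (hGB : ∀ k w K X, DifferentiableOn ℂ (GB k w K X) (U k w K X)) (hGA : ∀ k w K X, DifferentiableOn ℂ (GA k w K X) (U k w K X))
    (hrU : ∀ k w K X, ball (0 : Ec) r ⊆ U k w K X)
    (hfB : letI := θ.instVβ₁; letI := θ.instVβ₂
      ∀ (k : ℕ) (w : Fin (k + 2) → ℝ), w ∈ Box θ.γ (k + 1) → ∀ (K : ℕ) (X : (domSys (F.P (K + 1)) M (k + 1 + 1)).Dom) (B),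
        expChart (fun W' => (((S (K + 1)) (k + 1)).E w (emb (K + 1) (k + 1) W') X).re) θ.ρ8 B = (GB k w K X (ιc k w K X B)).re)
    (hfA : letI := θ.instVβ₁; letI := θ.instVβ₂
      ∀ (k : ℕ) (w : Fin (k + 2) → ℝ), w ∈ Box θ.γ (k + 1) → ∀ (K : ℕ) (X : (domSys (F.P (K + 1)) M (k + 1 + 1)).Dom) (B),
        expChart (fun W' : Fin (F.P (K + 1)).d → Site (F.P (K + 1)) (k + 1 + 1) → MatA N =>
          (((S K) k).E (Fin.tail w) (emb K k (fun κ' y => W' κ' (siteShift (ladder F K k) y))) (castDom (domSys_succ F M K (k + 1)) X)).re) θ.ρ8 B =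
          (GA k w K X (ιc k w K X B)).re)
    (hsup : ∀ (k : ℕ) (w : Fin (k + 2) → ℝ), w ∈ Box θ.γ (k + 1) → ∀ (K : ℕ) (X : (domSys (F.P (K + 1)) M (k + 1 + 1)).Dom), ∀ ζ ∈ ball (0 : Ec) r,
      ‖GB k w K X ζ - GA k w K X ζ‖ ≤ M₀ * θ₅ ^ (k + 1) * Real.exp (-κ * torusTreeLen X.1))
    (htail : letI := θ.instVβ₁; letI := θ.instVβ₂; letI := θ.instιβ
      ∀ (k : ℕ) (w : Fin (k + 2) → ℝ) (K : ℕ) (X : (domSys (F.P (K + 1)) M (k + 1 + 1)).Dom) (l : Fin (F.P (K + 1)).d) (t : Site (F.P (K + 1)) (k + 1 + 1)) (c : θ.ιβ),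
        let e : Site (F.P (K + 1)) (k + 1 + 1) → TPt 4 (domCount (F.P (K + 1)) M (k + 1 + 1) * M) :=
          fun x i => (ZMod.cast (x i) : ZMod (domCount (F.P (K + 1)) M (k + 1 + 1) * M))
        ‖ιc k w K X (Pi.single l (Pi.single t (θ.bV c)))‖ ≤ B₃ * Real.exp (-δ₀ * distCT (domCount (F.P (K + 1)) M (k + 1 + 1)) M (e t) (nearT (M := M) (e t) X)))
    (ℓ : U3Letters₁₁) (hs : ℓ.Signs) (hℓκ : ℓ.κ = delta1 δ₀ κ ((M : ℝ) * 4)) (hℓθ : ℓ.θ₅ = θ₅)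
    (hℓC : ℓ.C₅ = 16 * M₀ * B₃ ^ 2 / r ^ 2 * Real.exp (delta1 δ₀ κ ((M : ℝ) * 4) * ((M : ℝ) * 4) * 3) * K₀ (4 * 2 ^ 4) (2 * 4) * K₁ 4 (δ₀ / 2))
    (h9 : WindowedNE9OfRecord₁₃ F N θ ℓ.κ ℓ.moduli) (hW : WindowedDecayOfRecord₁₃ F N θ 0 1 ℓ.κ) :
    KernelDecayOfRecord₁₃ F N θ 0 1 ℓ.κ ∧ (∀ k : ℕ, N18At (u3OfRecord₁₃ θ (objectsOfRecord₁₃ F N θ ℓ) k)) ∧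
      ∀ k : ℕ, N22At (u3OfRecord₁₃ θ (objectsOfRecord₁₃ F N θ ℓ) k) := by
  obtain ⟨hrr, hinc, -, hS, -⟩ := u3LettersOfRecord₁₃_of_analyticLocalTermData F N m' M hM θ S emb hloc hκ0 hδ₀ hκ ha hω hω1 hr hE₀ hB₃ ι₁ G₁ U₁ hU₁ hG₁ hrU₁
    hf₁ hsup₁ htail₁ hstab hθ₅ hM₀ ιc GB GA U hU hGB hGA hrU hfB hfA hsup htail
  have hfin : WindowedStepRateOfRecord₁₃ F N θ 1 ℓ.κ ℓ.θ₅ (ℓ.C₅ * ℓ.θ₅) := by rw [hℓκ, hℓθ, hℓC]; exact hS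
  exact u3KernelInputs_of_finiteVolumeLetters F N θ ℓ hs 1 hrr hinc hfin h9 hW

end Objects

/-! ## Under a kernel-PINNED K3 reading (`(𝔯.lit F θ hP g₀ os).u3 = objectsOfRecord₁₃ F N θ ℓ`) -/

section Pin

open scoped Matrix.Norms.L2Operator

variable {𝔸 : Type*} {Ec : Type*} [NormedAddCommGroup Ec] [NormedSpace ℂ Ec]
variable (F : T4Family) {N : ℕ} [NeZero N] (m' : ℕ) (M : ℕ) [NeZero M] (hM : M = F.L ^ m')

include hM in
open Classical in
/-- ★ **THE N18 CONJUNCT OF A KERNEL-PINNED READING FROM THE TERM-DATA PACKAGE** (analytic edition): at a Stage-13 tuple with provisos `θ`, a rate reading `𝔯` whose u3 slot is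
PINNED to the ₁₃ objects of record of a letter reading `ℓ` keyed to the package's constants (`ℓ.κ = δ₁`, `ℓ.θ₅ = θ₅`, `ℓ.C₅ = C₅′`), PART 1's analytic package at
`θ.toStage13Params` ⇒ `N18At (rateCarriersOfRecord₁₃CoPH 𝔯 F θ hP g₀ os k).u3` at EVERY run length `k` (PART 1 §3 ∘ g6 `n18At_rateCarriers_of_kernels_pin_of_geometricIncrements`
at `s := 1`; no `h9 ∕ hW`, no `ℓ.Signs` needed for the N18 conjunct).  LOCATED; N18 NOT discharged; K3⁸ OPEN.
[cite: Balaban1987RG1, Thm 1 p.259, (1.7) p.261, (1.18) p.263, (1.20)-(1.21) p.264, (4.35)-(4.36) p.290, (4.37) p.291 and (5.10) p.293; Balaban1988RG2Cluster, (2.13)-(2.14) pp.14-15; King1986, (3.73) p.665] -/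
theorem n18At_rateCarriers_pin_of_analyticLocalTermData (𝔯 : RateReading₁₃CoPH N) (θ : Stage13HParams F N) (hP : θ.Provisos₁₃CoPH F N)
    (g₀ : ℕ → ℝ) (os : List (ULoop F)) (S : (K : ℕ) → ClusterTower (F.P K) 𝔸 M) (emb : ReadingMaps F (MatA N) 𝔸)
    (hloc : Localizes17OfRecord₁₃ F N θ.toStage13Params S emb) {κ δ₀ a ω r E₀ B₃ : ℝ} (hκ0 : 0 < κ) (hδ₀ : 0 < δ₀) (hκ : kappa₀ (4 * 2 ^ 4) (2 * 4) ≤ κ / 2 / 2) (ha : 0 ≤ a)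
    (hω : 0 < ω) (hω1 : ω < 1) (hr : 0 < r) (hE₀ : 0 ≤ E₀) (hB₃ : 0 ≤ B₃)
    (ι₁ : letI := θ.instVβ₁; letI := θ.instVβ₂
      (g : ℕ → ℝ) → (k K : ℕ) → (domSys (F.P K) M (k + 1)).Dom → ((Fin (F.P K).d → Site (F.P K) (k + 1) → θ.Vβ) →L[ℝ] Ec))
    (G₁ : (g : ℕ → ℝ) → (k K : ℕ) → (domSys (F.P K) M (k + 1)).Dom → Ec → ℂ)
    (U₁ : (g : ℕ → ℝ) → (k K : ℕ) → (domSys (F.P K) M (k + 1)).Dom → Set Ec) (hU₁ : ∀ g k K X, IsOpen (U₁ g k K X))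
    (hG₁ : ∀ g k K X, DifferentiableOn ℂ (G₁ g k K X) (U₁ g k K X)) (hrU₁ : ∀ g k K X, ball (0 : Ec) r ⊆ U₁ g k K X)
    (hf₁ : letI := θ.instVβ₁; letI := θ.instVβ₂
      ∀ g ∈ Window θ.γ, ∀ (k K : ℕ) (X : (domSys (F.P K) M (k + 1)).Dom) (B : Fin (F.P K).d → Site (F.P K) (k + 1) → θ.Vβ),
        expChart (fun W' => (((S K) k).E (histPrefix g k) (emb K k W') X).re) θ.ρ8 B = (G₁ g k K X (ι₁ g k K X B)).re)
    (hsup₁ : ∀ g ∈ Window θ.γ, ∀ (k K : ℕ) (X : (domSys (F.P K) M (k + 1)).Dom), ∀ ζ ∈ ball (0 : Ec) r, ‖G₁ g k K X ζ‖ ≤ E₀ * Real.exp (-κ * torusTreeLen X.1))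
    (htail₁ : letI := θ.instVβ₁; letI := θ.instVβ₂; letI := θ.instιβ
      ∀ (g : ℕ → ℝ) (k K : ℕ) (X : (domSys (F.P K) M (k + 1)).Dom) (l : Fin (F.P K).d) (t : Site (F.P K) (k + 1)) (c : θ.ιβ),
        let e : Site (F.P K) (k + 1) → TPt 4 (domCount (F.P K) M (k + 1) * M) := fun x i => (ZMod.cast (x i) : ZMod (domCount (F.P K) M (k + 1) * M))
        ‖ι₁ g k K X (Pi.single l (Pi.single t (θ.bV c)))‖ ≤ B₃ * Real.exp (-δ₀ * distCT (domCount (F.P K) M (k + 1)) M (e t) (nearT (M := M) (e t) X)))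
    (hstab : letI := θ.instVβ₁; letI := θ.instVβ₂; letI := θ.instιβ
      ∀ g ∈ Window θ.γ, ∀ (k : ℕ) (μ ν : Fin 4) (z : Fin 4 → ℤ), ∃ (Ks : ℕ) (A : ℝ), 0 ≤ A ∧ ∀ R : ℝ, 0 ≤ R → ∀ K, Ks ≤ K →
        |(∑ X ∈ Finset.univ.filter (fun X : (domSys (F.P (K + 1)) M (k + 1)).Dom =>
            ¬ (R < torusTreeLen X.1 ∨ R < distCT (domCount (F.P (K + 1)) M (k + 1)) M
              (fun i : Fin 4 => (ZMod.cast (siteOfInt F (K + 1) (k + 1) 0 i) : ZMod (domCount (F.P (K + 1)) M (k + 1) * M)))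
              (nearT (M := M) (fun i : Fin 4 => (ZMod.cast (siteOfInt F (K + 1) (k + 1) 0 i) : ZMod (domCount (F.P (K + 1)) M (k + 1) * M))) X))),
            polScalar (fun W' => (((S (K + 1)) k).E (histPrefix g k) (emb (K + 1) k W') X).re) θ.ρ8 θ.bV (Fin.cast (F.P_d (K + 1)).symm μ) (siteOfInt F (K + 1) (k + 1) z)
              (Fin.cast (F.P_d (K + 1)).symm ν) (siteOfInt F (K + 1) (k + 1) 0)) -
          (∑ X ∈ Finset.univ.filter (fun X : (domSys (F.P K) M (k + 1)).Dom =>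
            ¬ (R < torusTreeLen X.1 ∨ R < distCT (domCount (F.P K) M (k + 1)) M
              (fun i : Fin 4 => (ZMod.cast (siteOfInt F K (k + 1) 0 i) : ZMod (domCount (F.P K) M (k + 1) * M)))
              (nearT (M := M) (fun i : Fin 4 => (ZMod.cast (siteOfInt F K (k + 1) 0 i) : ZMod (domCount (F.P K) M (k + 1) * M))) X))),
            polScalar (fun W' => (((S K) k).E (histPrefix g k) (emb K k W') X).re) θ.ρ8 θ.bV (Fin.cast (F.P_d K).symm μ) (siteOfInt F K (k + 1) z)
              (Fin.cast (F.P_d K).symm ν) (siteOfInt F K (k + 1) 0))| ≤ A * Real.exp (a * R) * ω ^ K)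
    {θ₅ M₀ : ℝ} (hθ₅ : 0 ≤ θ₅) (hM₀ : 0 ≤ M₀)
    (ιc : letI := θ.instVβ₁; letI := θ.instVβ₂
      (k : ℕ) → (Fin (k + 2) → ℝ) → (K : ℕ) → (domSys (F.P (K + 1)) M (k + 1 + 1)).Dom → ((Fin (F.P (K + 1)).d → Site (F.P (K + 1)) (k + 1 + 1) → θ.Vβ) →L[ℝ] Ec))
    (GB GA : (k : ℕ) → (Fin (k + 2) → ℝ) → (K : ℕ) → (domSys (F.P (K + 1)) M (k + 1 + 1)).Dom → Ec → ℂ)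
    (U : (k : ℕ) → (Fin (k + 2) → ℝ) → (K : ℕ) → (domSys (F.P (K + 1)) M (k + 1 + 1)).Dom → Set Ec) (hU : ∀ k w K X, IsOpen (U k w K X))
    (hGB : ∀ k w K X, DifferentiableOn ℂ (GB k w K X) (U k w K X)) (hGA : ∀ k w K X, DifferentiableOn ℂ (GA k w K X) (U k w K X))
    (hrU : ∀ k w K X, ball (0 : Ec) r ⊆ U k w K X)
    (hfB : letI := θ.instVβ₁; letI := θ.instVβ₂
      ∀ (k : ℕ) (w : Fin (k + 2) → ℝ), w ∈ Box θ.γ (k + 1) → ∀ (K : ℕ) (X : (domSys (F.P (K + 1)) M (k + 1 + 1)).Dom) (B),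
        expChart (fun W' => (((S (K + 1)) (k + 1)).E w (emb (K + 1) (k + 1) W') X).re) θ.ρ8 B = (GB k w K X (ιc k w K X B)).re)
    (hfA : letI := θ.instVβ₁; letI := θ.instVβ₂
      ∀ (k : ℕ) (w : Fin (k + 2) → ℝ), w ∈ Box θ.γ (k + 1) → ∀ (K : ℕ) (X : (domSys (F.P (K + 1)) M (k + 1 + 1)).Dom) (B),
        expChart (fun W' : Fin (F.P (K + 1)).d → Site (F.P (K + 1)) (k + 1 + 1) → MatA N =>
          (((S K) k).E (Fin.tail w) (emb K k (fun κ' y => W' κ' (siteShift (ladder F K k) y))) (castDom (domSys_succ F M K (k + 1)) X)).re) θ.ρ8 B =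
          (GA k w K X (ιc k w K X B)).re)
    (hsup : ∀ (k : ℕ) (w : Fin (k + 2) → ℝ), w ∈ Box θ.γ (k + 1) → ∀ (K : ℕ) (X : (domSys (F.P (K + 1)) M (k + 1 + 1)).Dom), ∀ ζ ∈ ball (0 : Ec) r,
      ‖GB k w K X ζ - GA k w K X ζ‖ ≤ M₀ * θ₅ ^ (k + 1) * Real.exp (-κ * torusTreeLen X.1))
    (htail : letI := θ.instVβ₁; letI := θ.instVβ₂; letI := θ.instιβ
      ∀ (k : ℕ) (w : Fin (k + 2) → ℝ) (K : ℕ) (X : (domSys (F.P (K + 1)) M (k + 1 + 1)).Dom) (l : Fin (F.P (K + 1)).d) (t : Site (F.P (K + 1)) (k + 1 + 1)) (c : θ.ιβ),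
        let e : Site (F.P (K + 1)) (k + 1 + 1) → TPt 4 (domCount (F.P (K + 1)) M (k + 1 + 1) * M) :=
          fun x i => (ZMod.cast (x i) : ZMod (domCount (F.P (K + 1)) M (k + 1 + 1) * M))
        ‖ιc k w K X (Pi.single l (Pi.single t (θ.bV c)))‖ ≤ B₃ * Real.exp (-δ₀ * distCT (domCount (F.P (K + 1)) M (k + 1 + 1)) M (e t) (nearT (M := M) (e t) X)))
    (ℓ : U3Letters₁₁) (hpin : (𝔯.lit F θ hP g₀ os).u3 = objectsOfRecord₁₃ F N θ.toStage13Params ℓ) (hℓκ : ℓ.κ = delta1 δ₀ κ ((M : ℝ) * 4))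
    (hℓθ : ℓ.θ₅ = θ₅)
    (hℓC : ℓ.C₅ = 16 * M₀ * B₃ ^ 2 / r ^ 2 * Real.exp (delta1 δ₀ κ ((M : ℝ) * 4) * ((M : ℝ) * 4) * 3) * K₀ (4 * 2 ^ 4) (2 * 4) * K₁ 4 (δ₀ / 2)) (k : ℕ) :
    N18At (rateCarriersOfRecord₁₃CoPH 𝔯 F θ hP g₀ os k).u3 := by
  obtain ⟨hrr, hinc, -, hS, -⟩ := u3LettersOfRecord₁₃_of_analyticLocalTermData F N m' M hM θ.toStage13Params S emb hloc hκ0 hδ₀ hκ ha hω hω1 hr hE₀ hB₃ ι₁ G₁ U₁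
    hU₁ hG₁ hrU₁ hf₁ hsup₁ htail₁ hstab hθ₅ hM₀ ιc GB GA U hU hGB hGA hrU hfB hfA hsup htail
  have hfin : WindowedStepRateOfRecord₁₃ F N θ.toStage13Params 1 ℓ.κ ℓ.θ₅ (ℓ.C₅ * ℓ.θ₅) := by rw [hℓκ, hℓθ, hℓC]; exact hS
  exact n18At_rateCarriers_of_kernels_pin_of_geometricIncrements F 𝔯 θ hP g₀ os ℓ hpin k 1 hrr hinc hfin

end Pin

end YMDAG.N18.U3LettersPackage

end
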